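import Mathlib.Tactic.FieldSimp
import Mathlib.Tactic.LinearCombination
import Literature.Combinatorics.Matroid.ShuffleChar
import Literature.NumberTheory.Transcendental.MZVWordShuffle
import HarnessLib

/-!
# The characters of the shuffle algebra, II: Prop. 2.24 and Lemma 2.23 of Panzer 2022 — proved

`Char` is multiplicative on shuffles (Panzer 2022, Prop. 2.24 [Panzer2022], "symmetral moulds",
Rem. 2.25) and `dChar` vanishes on shuffles of two non-empty words with opposite sums
(Lemma 2.23), both in the right-to-left reading `suffixChar` of `ShuffleChar.lean` and for the
tree's shuffle product of words `MZV.shuffleWord`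
(`Literature/NumberTheory/Transcendental/MZVWordShuffle.lean`, reused, not redefined), pointwise
in a field wherever the suffix sums occurring are non-zero (the source proves them as identities
of rational functions in the letters).

## Contents (namespace `Literature.Combinatorics.Matroid`)

* `sum_of_mem_shuffleWord` (letters are preserved), `sum_suffixChar_shuffleWord` — **Prop. 2.24**,
  `sum_suffixChar_tail_shuffleWord_eq_zero` — **Lemma 2.23**.
-/

namespace Literature.Combinatorics.Matroid

open Literature.NumberTheory.Transcendental

variable {𝕜 : Type*} [Field 𝕜]

/-! ### Shuffles preserve the letters -/

/-- An interleaving of `u` and `v` has the same letters, hence the same sum `|u| + |v|`. [folklore] -/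
theorem sum_of_mem_shuffleWord : ∀ (u v : List 𝕜) {w : List 𝕜}, w ∈ MZV.shuffleWord u v →
    w.sum = u.sum + v.sum
  | [], v, w, hw => by simp_all
  | a :: u, [], w, hw => by simp_all
  | a :: u, b :: v, w, hw => by
    simp only [MZV.shuffleWord_cons_cons, List.mem_append, List.mem_map] at hw
    rcases hw with ⟨w', hw', rfl⟩ | ⟨w', hw', rfl⟩
    · rw [List.sum_cons, sum_of_mem_shuffleWord u (b :: v) hw']
      simp only [List.sum_cons]
      ring
    · rw [List.sum_cons, sum_of_mem_shuffleWord (a :: u) v hw']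
      simp only [List.sum_cons]
      ring

/-! ### Prop. 2.24: `Char` is multiplicative on shuffles -/

/-- **`Char` is symmetral** (Panzer 2022, Prop. 2.24: `Char(a ⧢ b) = Char(a) Char(b)`; Rem. 2.25),
in the right-to-left reading: the sum of `suffixChar` over all interleavings of `u` and `v` (with
multiplicity) is `suffixChar u · suffixChar v`, at every point where the suffix sums of `u`, of
`v` and of all the interleavings are non-zero. Proof as printed: recursion on the first letters,
`(a u) ⧢ (b v) = a (u ⧢ b v) + b (a u ⧢ v)`, and
`(A+B)⁻¹ (B⁻¹ + A⁻¹) = A⁻¹ B⁻¹` for the full sums `A = |a u|`, `B = |b v|`. [cite: Panzer2022, Prop. 2.24] -/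
theorem sum_suffixChar_shuffleWord : ∀ (u v : List 𝕜), SuffixSumsNeZero u → SuffixSumsNeZero v →
    (∀ w ∈ MZV.shuffleWord u v, SuffixSumsNeZero w) →
      ((MZV.shuffleWord u v).map suffixChar).sum = suffixChar u * suffixChar v
  | [], v, _, _, _ => by simp
  | a :: u, [], _, _, _ => by simp
  | a :: u, b :: v, hu, hv, hsh => by
    have hA : (a :: u).sum ≠ 0 := hu.sum_ne_zero (List.cons_ne_nil a u)
    have hB : (b :: v).sum ≠ 0 := hv.sum_ne_zero (List.cons_ne_nil b v)
    -- the full sum `T = A + B` of every interleaving is non-zero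
    have hT : (a :: u).sum + (b :: v).sum ≠ 0 := by
      have hmem : a :: (u ++ b :: v) ∈ MZV.shuffleWord (a :: u) (b :: v) := by
        rw [MZV.shuffleWord_cons_cons, List.mem_append, List.mem_map]
        refine Or.inl ⟨u ++ b :: v, ?_, rfl⟩
        clear hu hv hsh hA hB
        induction u with
        | nil => cases v <;> simp
        | cons c u ih =>
          rw [List.cons_append, MZV.shuffleWord_cons_cons, List.mem_append, List.mem_map]
          exact Or.inl ⟨_, ih, rfl⟩
      have h := (hsh _ hmem).sum_ne_zero (List.cons_ne_nil _ _)
      rw [sum_of_mem_shuffleWord (a :: u) (b :: v) hmem] at h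
      exact h
    -- the two halves of the recursion
    have h1 : ((MZV.shuffleWord u (b :: v)).map (suffixChar ∘ List.cons a)).sum =
        ((a :: u).sum + (b :: v).sum)⁻¹ * (suffixChar u * suffixChar (b :: v)) := by
      rw [← sum_suffixChar_shuffleWord u (b :: v) hu.of_cons hv (fun w hw =>
          (hsh (a :: w) (by
            rw [MZV.shuffleWord_cons_cons, List.mem_append]
            exact Or.inl (List.mem_map.2 ⟨w, hw, rfl⟩))).of_cons), ← List.sum_map_mul_left]
      refine congrArg List.sum (List.map_congr_left fun w hw => ?_)
      rw [Function.comp_apply, suffixChar_cons, sum_of_mem_shuffleWord u (b :: v) hw]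
      simp only [List.sum_cons]
      ring_nf
    have h2 : ((MZV.shuffleWord (a :: u) v).map (suffixChar ∘ List.cons b)).sum =
        ((a :: u).sum + (b :: v).sum)⁻¹ * (suffixChar (a :: u) * suffixChar v) := by
      rw [← sum_suffixChar_shuffleWord (a :: u) v hu hv.of_cons (fun w hw =>
          (hsh (b :: w) (by
            rw [MZV.shuffleWord_cons_cons, List.mem_append]
            exact Or.inr (List.mem_map.2 ⟨w, hw, rfl⟩))).of_cons), ← List.sum_map_mul_left]
      refine congrArg List.sum (List.map_congr_left fun w hw => ?_)
      rw [Function.comp_apply, suffixChar_cons, sum_of_mem_shuffleWord (a :: u) v hw]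
      simp only [List.sum_cons]
      ring_nf
    rw [MZV.shuffleWord_cons_cons, List.map_append, List.sum_append, List.map_map, List.map_map,
      h1, h2, suffixChar_cons a u, suffixChar_cons b v]
    rw [List.sum_cons, List.sum_cons] at hT ⊢
    rw [List.sum_cons] at hA hB
    field_simp

/-! ### Lemma 2.23: `dChar` vanishes on shuffles of words with opposite sums -/

/-- **Lemma 2.23** (Panzer 2022): if `u` and `v` are non-empty words with `|u| + |v| = 0`, then
`dChar(u ⧢ v) = 0`; in the right-to-left reading `dChar` of a word `w` is `suffixChar (w.tail)`
(drop the LAST letter of Panzer's word = the FIRST letter of the reversed word), and the claim is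
`Σ_{w ∈ u ⧢ v} suffixChar (w.tail) = 0`, at every point where the suffix sums of `u`, `v` and the
proper suffix sums of the interleavings are non-zero. Proof: the first-letter recursion and
Prop. 2.24 give `Char(u') Char(v) + Char(u) Char(v') = Char(u') Char(v') (B⁻¹ + A⁻¹)` with
`A + B = 0`. [cite: Panzer2022, Lemma 2.23] -/
theorem sum_suffixChar_tail_shuffleWord_eq_zero (u v : List 𝕜) (hu0 : u ≠ []) (hv0 : v ≠ [])
    (hu : SuffixSumsNeZero u) (hv : SuffixSumsNeZero v) (hsum : u.sum + v.sum = 0)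
    (hsh : ∀ w ∈ MZV.shuffleWord u v, SuffixSumsNeZero w.tail) :
    ((MZV.shuffleWord u v).map fun w => suffixChar w.tail).sum = 0 := by
  obtain ⟨a, u, rfl⟩ := List.exists_cons_of_ne_nil hu0
  obtain ⟨b, v, rfl⟩ := List.exists_cons_of_ne_nil hv0
  have hA : (a :: u).sum ≠ 0 := hu.sum_ne_zero (List.cons_ne_nil a u)
  have hB : (b :: v).sum ≠ 0 := hv.sum_ne_zero (List.cons_ne_nil b v)
  have h1 : ((MZV.shuffleWord u (b :: v)).map ((fun w => suffixChar w.tail) ∘ List.cons a)).sum =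
      suffixChar u * suffixChar (b :: v) := by
    rw [← sum_suffixChar_shuffleWord u (b :: v) hu.of_cons hv (fun w hw => hsh (a :: w) (by
        rw [MZV.shuffleWord_cons_cons, List.mem_append]
        exact Or.inl (List.mem_map.2 ⟨w, hw, rfl⟩)))]
    rfl
  have h2 : ((MZV.shuffleWord (a :: u) v).map ((fun w => suffixChar w.tail) ∘ List.cons b)).sum =
      suffixChar (a :: u) * suffixChar v := by
    rw [← sum_suffixChar_shuffleWord (a :: u) v hu hv.of_cons (fun w hw => hsh (b :: w) (by
        rw [MZV.shuffleWord_cons_cons, List.mem_append]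
        exact Or.inr (List.mem_map.2 ⟨w, hw, rfl⟩)))]
    rfl
  rw [MZV.shuffleWord_cons_cons, List.map_append, List.sum_append, List.map_map, List.map_map,
    h1, h2, suffixChar_cons a u, suffixChar_cons b v]
  rw [List.sum_cons, List.sum_cons] at hsum
  rw [List.sum_cons] at hA hB
  have hb : b + v.sum = -(a + u.sum) := by linear_combination hsum
  rw [hb, inv_neg]
  ring

end Literature.Combinatorics.Matroid
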